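import Summits.BirchSwinnertonDyer.BirchSwinnertonDyer.Theorems.SylvesterTwoHeegnerIndexParametrizationRigidity
import Literature.NumberTheory.EllipticCurves.HuShuYin2019.SylvesterHeegnerHeightDisplayNamed
import HarnessLib

/-!
# Route `SylvesterTwoHeegnerIndex` (rung K7t): the `∀`-over-degree-6 pinning of the NAMED height display #19
# (`HuShuYin2019.shaAnPair_mul_height_eq_two_zpow_mul_height_named`) costs nothing beyond ONE degree-6 datum —
# rigidity of `ModularParametrizationData` (print input #19 of crux `UpperOffV0HSYPlus` stmt-BirchSwinnertonDyer-19804 /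
# hand item `HeegnerIndexUpperAtTwoHSY` stmt-…-19229; planner D855 «(#19-MIN)»)

Cell `bsd-cm`, seat `bsd-cm-k7t-c2` g35.  THEOREMS ONLY: no definition, no named fact, no instance, no notation, no `sorry`.
`--supports stmt-BirchSwinnertonDyer-19804 --as helper`.

## What is proved

The named print fact #19 quantifies its NAMING CLAUSE (2) over EVERY modular parametrisation datum `Dt` of
`E₉ = ⟨0,0,1,0,−1⟩` at level `243` with `Dt.deg = 6` («the CM point `y₁` over `Dt.φ(τ_{Q_p})` …»), whereas Hu–Shu–Yin
compute with ONE map, the `S₃`-quotient `f : X₀(3⁵) → E₉` of degree `6` (Prop. 2.1 (1), §4.1 p. 10 L59, p. 11 L23); the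
fact's own docstring justifies the `∀` by «every degree-6 datum is `±f`».  That justification is now a tree theorem
(`SylvesterTwoParamRigidity.φ_eq_or_eq_neg_of_deg_eq`, p756959: two data of equal degree have `φ' = ±φ`), and this file
carries it through clause (2): ★ `named_of_named_at Dt₀ hdeg₀` — **#19 with clause (2) instantiated at ONE degree-6
datum `Dt₀` implies #19 as typed** (for another degree-6 `Dt`, either `Dt.φ = Dt₀.φ` and the clause is the same, or
`Dt.φ = −Dt₀.φ` and one feeds `−y₁` to the clause at `Dt₀` and negates its outputs: `T ↦ −T` (still `3`-torsion),
`Y₁ ↦ −Y₁`, `Y ↦ −Y`; every map in the clause — `Affine.Point.map`, `pointGalHom g`, `ιpt`, `κ.symm`, `ψ`,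
`toGeomPoints`, `congrEquiv ∘ pointEquivBaseChange` — is additive, and `canonicalHeight (−Y) = canonicalHeight Y`).
Also the converse `named_at_of_named` (trivial specialisation).

BOOK VALUE (planner D855): the kernel certificate that #19's `∀`-over-degree-6 pinning is harmless — the twin of
(G3-MIN) (p757397/p757855 for (G3)); the INPUTS desk may later re-name #19 print-exact (clause (2) over ONE datum)
with the `∀`-form derived in-file.  Nothing in the registered skeleton (VARIANT T b9169ddf8e214d10) moves.

Honest label: faithfulness / bookkeeping of a CITED display; CONDITIONAL (both sides are hypotheses); nothing asserted
on 19804; no ledger item closed; `X12.CMAtTwo` NOT proved; BSD proved for no curve.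

## References

* Y. Hu, J. Shu, H. Yin, *An explicit Gross–Zagier formula related to the Sylvester conjecture*, Trans. AMS 372 (2019)
  = arXiv:1708.05266: display (bsd) p. 12, Cor. 4.4 / Thm. 4.3 (p. 11), §4.1 (p. 10 L59, L92–94; p. 11 L23), §3 (p. 8),
  Prop. 2.1 (1) (p. 5). [HuShuYin2019]
* B. Edixhoven, *On the Manin constants of modular elliptic curves* (1991), §1. [EdixhovenManin1991]
* J. H. Silverman, *The Arithmetic of Elliptic Curves*, 2nd ed. (2009), VIII.9.3 (b) (`ĥ(−P) = ĥ(P)`). [SilvermanAEC2009]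
-/

set_option linter.dupNamespace false -- Summits modules are `Summit.<Summit>.<Problem>…` by design
set_option autoImplicit false

noncomputable section

open scoped Classical

open WeierstrassCurve WeierstrassCurve.Affine WeierstrassCurve.Affine.Point
open Literature.NumberTheory.EllipticCurves Literature.NumberTheory.EllipticCurves.ModularForms
  Literature.NumberTheory.EllipticCurves.HuShuYin2019
open Summit.BirchSwinnertonDyer.BirchSwinnertonDyer.Theorems

namespace Summit.BirchSwinnertonDyer.BirchSwinnertonDyer.Theorems.SylvesterTwoHeightDisplayNamedDegSix

set_option maxHeartbeats 800000 in
/-- ★ **#19 with its naming clause (2) at ONE degree-6 datum `Dt₀` implies #19 as typed** (`∀ Dt, Dt.deg = 6 → …`):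
two degree-6 data have `φ' = ±φ` (`SylvesterTwoParamRigidity.φ_eq_or_eq_neg_of_deg_eq`); in the `−` case feed `−y₁` to the
clause at `Dt₀` and negate `T`, `Y₁`, `Y` — all maps in the clause are additive and `ĥ(−Y) = ĥ(Y)`.  The hypothesis `h` is
the body of `shaAnPair_mul_height_eq_two_zpow_mul_height_named` VERBATIM except that «`∀ (Dt : …), Dt.deg = 6 →`» is
instantiated at `Dt₀`.  CONDITIONAL; asserts nothing by itself; BSD is proved for no curve.
[cite: HuShuYin2019, display (bsd) p. 12, Cor. 4.4 (p. 11), §4.1 (p. 10 L59, L92–94; p. 11 L23), §3 (p. 8), Prop. 2.1 (1)]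
[cite: EdixhovenManin1991, §1] [cite: SilvermanAEC2009, Thm. VIII.9.3 (b)] -/
theorem named_of_named_at
    (Dt₀ : ModularParametrizationData (⟨0, 0, 1, 0, -1⟩ : WeierstrassCurve ℚ) 243) (hdeg₀ : Dt₀.deg = 6)
    (h :
      ∀ (p : ℕ), p.Prime → (p % 9 = 4 ∨ p % 9 = 7) → (¬ ∃ x : ZMod p, x ^ 3 = 3) →
        ∀ (K : Type) [Field K] [NumberField K] (ω : K), ω ^ 2 + ω + 1 = 0 → Module.finrank ℚ K = 2 →
          -- (1) the display (bsd) as in `shaAnPair_mul_height_eq_two_zpow_mul_height` (`Y` existential)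
          (∀ (A B : WeierstrassCurve ℚ) [A.IsElliptic] [A.IsGloballyMinimal]
              [B.IsElliptic] [B.IsGloballyMinimal],
            (∃ C : VariableChange ℚ, C • B = cubeSumCurve (p : ℚ)) →
            (∃ C : VariableChange ℚ, C • A = cubeSumCurve (3 * (p : ℚ) ^ 2)) →
            ∃ qB qA : ℚ, shaAn B = (qB : ℂ) ∧ shaAn A = (qA : ℂ) ∧ qB * qA ≠ 0 ∧
              (B.baseChange K).mordellWeilRank = 2 ∧
              ∃ (P : B.toAffine.Point) (Y : (B.baseChange K).toAffine.Point),
                ¬ IsOfFinAddOrder (WeierstrassCurve.QuadraticDescent.incl K B P) ∧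
                (∀ Q : B.toAffine.Point, ∃ m : ℤ, IsOfFinAddOrder
                  (WeierstrassCurve.QuadraticDescent.incl K B Q -
                    m • WeierstrassCurve.QuadraticDescent.incl K B P)) ∧
                ((qB * qA : ℚ) : ℝ) * canonicalHeight (WeierstrassCurve.QuadraticDescent.incl K B P) =
                  (2 : ℝ) ^ (if p % 9 = 4 then (0 : ℤ) else -2) * canonicalHeight Y) ∧
          -- (2) THE NAMING CLAUSE: the same display holds with `Y :=` Hu–Shu–Yin's point `R − T` on `E_p(K)`
          ∀ (ι₀ : K →+* ℂ),
          ∀ (y₁ : ((⟨0, 0, 1, 0, -1⟩ : WeierstrassCurve ℚ).baseChange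
              (ringClassField K ι₀ (9 * p))).toAffine.Point),
            Affine.Point.map (W' := (⟨0, 0, 1, 0, -1⟩ : WeierstrassCurve ℚ))
                (ringClassField K ι₀ (9 * p)).subtype.toRatAlgHom y₁ =
              Dt₀.φ (heegnerTau (81 * ((p : ℤ) ^ 2 + 4 * p + 16), -(9 * (4 * (p : ℤ) ^ 2 + 17 * p + 72)),
                4 * (p : ℤ) ^ 2 + 18 * p + 81)) →
          ∀ (c₃ cp : ringClassField K ι₀ (9 * p)), c₃ ^ 3 = 3 → cp ^ 3 = (p : ringClassField K ι₀ (9 * p)) →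
          ∀ (G : Finset (ringClassField K ι₀ (9 * p) ≃ₐ[ℚ] ringClassField K ι₀ (9 * p))),
            (∀ g, g ∈ G ↔ (∀ k : K, g (algebraMap K (ringClassField K ι₀ (9 * p)) k) =
              algebraMap K (ringClassField K ι₀ (9 * p)) k) ∧ g c₃ = c₃ ∧ g cp = cp) →
          ∀ (emb : ringClassField K ι₀ (9 * p) →+* AlgebraicClosure K),
            (∀ k : K, emb (algebraMap K (ringClassField K ι₀ (9 * p)) k) =
              algebraMap K (AlgebraicClosure K) k) →
          ∀ (ιpt : ((⟨0, 0, 1, 0, -1⟩ : WeierstrassCurve ℚ).baseChange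
                (ringClassField K ι₀ (9 * p))).toAffine.Point →+
              geomPoints (((⟨0, 0, 1, 0, -1⟩ : WeierstrassCurve ℚ)).baseChange K)),
            (∀ Q, ιpt Q = Affine.Point.map (W' := (⟨0, 0, 1, 0, -1⟩ : WeierstrassCurve ℚ))
              emb.toRatAlgHom Q) →
          ∀ (κ : geomPoints ((cubeSumCurve (9 : ℚ)).baseChange K) ≃+
              geomPoints (((⟨0, 0, 1, 0, -1⟩ : WeierstrassCurve ℚ)).baseChange K)),
            (∀ {x y : AlgebraicClosure K}
              (h : (((cubeSumCurve (9 : ℚ)).baseChange K).baseChange (AlgebraicClosure K)).toAffine.Nonsingular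
                x y),
              ∃ h', κ (Affine.Point.some x y h) = Affine.Point.some (x / 36) ((y - 108) / 216) h') →
          ∀ (v : AlgebraicClosure K), v ^ 3 = (p : AlgebraicClosure K) / 9 →
          ∀ (ψ : geomPoints ((cubeSumCurve (9 : ℚ)).baseChange K) ≃+
              geomPoints ((cubeSumCurve (p : ℚ)).baseChange K)),
            (∀ {x y : AlgebraicClosure K}
              (h : (((cubeSumCurve (9 : ℚ)).baseChange K).baseChange (AlgebraicClosure K)).toAffine.Nonsingular
                x y),
              ∃ h', ψ (Affine.Point.some x y h) = Affine.Point.some (v ^ 2 * x) (v ^ 3 * y) h') →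
          ∃ T : ((⟨0, 0, 1, 0, -1⟩ : WeierstrassCurve ℚ).baseChange (ringClassField K ι₀ (9 * p))).toAffine.Point,
            3 • T = 0 ∧
          ∃ Y₁ : ((cubeSumCurve (p : ℚ)).baseChange K).toAffine.Point,
            toGeomPoints ((cubeSumCurve (p : ℚ)).baseChange K) Y₁ =
              ψ (κ.symm (ιpt ((∑ g ∈ G, pointGalHom (⟨0, 0, 1, 0, -1⟩ : WeierstrassCurve ℚ)
                (ringClassField K ι₀ (9 * p)) g y₁) - T))) ∧
            ∀ (A B : WeierstrassCurve ℚ) [A.IsElliptic] [A.IsGloballyMinimal]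
                [B.IsElliptic] [B.IsGloballyMinimal] (CB : VariableChange ℚ)
                (hCB : CB • B = cubeSumCurve (p : ℚ)),
              (∃ C : VariableChange ℚ, C • A = cubeSumCurve (3 * (p : ℚ) ^ 2)) →
              ∃ qB qA : ℚ, shaAn B = (qB : ℂ) ∧ shaAn A = (qA : ℂ) ∧ qB * qA ≠ 0 ∧
                (B.baseChange K).mordellWeilRank = 2 ∧
                ∃ (P : B.toAffine.Point) (Y : (B.baseChange K).toAffine.Point),
                  ¬ IsOfFinAddOrder (WeierstrassCurve.QuadraticDescent.incl K B P) ∧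
                  (∀ Q : B.toAffine.Point, ∃ m : ℤ, IsOfFinAddOrder
                    (WeierstrassCurve.QuadraticDescent.incl K B Q -
                      m • WeierstrassCurve.QuadraticDescent.incl K B P)) ∧
                  ((qB * qA : ℚ) : ℝ) * canonicalHeight (WeierstrassCurve.QuadraticDescent.incl K B P) =
                    (2 : ℝ) ^ (if p % 9 = 4 then (0 : ℤ) else -2) * canonicalHeight Y ∧
                  Affine.Point.congrEquiv (congrArg (fun W : WeierstrassCurve ℚ ↦ W.baseChange K) hCB)
                    (VariableChange.pointEquivBaseChange B CB K Y) = Y₁) :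
    shaAnPair_mul_height_eq_two_zpow_mul_height_named := by
  intro p hp h49 h3 K _ _ ω hω h2
  obtain ⟨h₁, h₂⟩ := h p hp h49 h3 K ω hω h2
  refine ⟨h₁, ?_⟩
  intro ι₀ Dt hdeg y₁ hy₁ c₃ cp hc₃ hcp G hG emb hemb ιpt hιpt κ hκ v hv ψ hψ
  rcases SylvesterTwoParamRigidity.φ_eq_or_eq_neg_of_deg_eq Dt₀ Dt (hdeg.trans hdeg₀.symm) with e | e
  · exact h₂ ι₀ y₁ (hy₁.trans (e _)) c₃ cp hc₃ hcp G hG emb hemb ιpt hιpt κ hκ v hv ψ hψ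
  · have hy₁' : Affine.Point.map (W' := (⟨0, 0, 1, 0, -1⟩ : WeierstrassCurve ℚ))
        (ringClassField K ι₀ (9 * p)).subtype.toRatAlgHom (-y₁) =
        Dt₀.φ (heegnerTau (81 * ((p : ℤ) ^ 2 + 4 * p + 16), -(9 * (4 * (p : ℤ) ^ 2 + 17 * p + 72)),
          4 * (p : ℤ) ^ 2 + 18 * p + 81)) := by
      rw [map_neg, hy₁, e, neg_neg]
    obtain ⟨T, hT, Y₁, hY₁, hdisp⟩ := h₂ ι₀ (-y₁) hy₁' c₃ cp hc₃ hcp G hG emb hemb ιpt hιpt κ hκ v hv ψ hψ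
    refine ⟨-T, by rw [smul_neg, hT, _root_.neg_zero], -Y₁, ?_, ?_⟩
    · have hsum : (∑ g ∈ G, pointGalHom (⟨0, 0, 1, 0, -1⟩ : WeierstrassCurve ℚ)
            (ringClassField K ι₀ (9 * p)) g (-y₁)) - T =
          -((∑ g ∈ G, pointGalHom (⟨0, 0, 1, 0, -1⟩ : WeierstrassCurve ℚ)
            (ringClassField K ι₀ (9 * p)) g y₁) - -T) := by
        simp only [map_neg, Finset.sum_neg_distrib, sub_neg_eq_add, neg_add_rev]
        abel
      rw [map_neg, hY₁, hsum, map_neg, map_neg, map_neg, neg_neg]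
    · intro A B _ _ _ _ CB hCB hA
      obtain ⟨qB, qA, hqB, hqA, hne, hrk, P, Y, hP, hgen, hht, htr⟩ := hdisp A B CB hCB hA
      refine ⟨qB, qA, hqB, hqA, hne, hrk, P, -Y, hP, hgen, ?_, ?_⟩
      · rwa [canonicalHeight_neg]
      · rw [map_neg, map_neg, htr]

/-- **The converse** (trivial specialisation): #19 as typed gives its clause (2) at any ONE degree-6 datum.
[cite: HuShuYin2019, display (bsd) p. 12, Cor. 4.4 (p. 11), §4.1 (p. 10 L59; p. 11 L23)] -/
theorem named_at_of_named (h : shaAnPair_mul_height_eq_two_zpow_mul_height_named)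
    (Dt₀ : ModularParametrizationData (⟨0, 0, 1, 0, -1⟩ : WeierstrassCurve ℚ) 243) (hdeg₀ : Dt₀.deg = 6) :
      ∀ (p : ℕ), p.Prime → (p % 9 = 4 ∨ p % 9 = 7) → (¬ ∃ x : ZMod p, x ^ 3 = 3) →
        ∀ (K : Type) [Field K] [NumberField K] (ω : K), ω ^ 2 + ω + 1 = 0 → Module.finrank ℚ K = 2 →
          -- (1) the display (bsd) as in `shaAnPair_mul_height_eq_two_zpow_mul_height` (`Y` existential)
          (∀ (A B : WeierstrassCurve ℚ) [A.IsElliptic] [A.IsGloballyMinimal]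
              [B.IsElliptic] [B.IsGloballyMinimal],
            (∃ C : VariableChange ℚ, C • B = cubeSumCurve (p : ℚ)) →
            (∃ C : VariableChange ℚ, C • A = cubeSumCurve (3 * (p : ℚ) ^ 2)) →
            ∃ qB qA : ℚ, shaAn B = (qB : ℂ) ∧ shaAn A = (qA : ℂ) ∧ qB * qA ≠ 0 ∧
              (B.baseChange K).mordellWeilRank = 2 ∧
              ∃ (P : B.toAffine.Point) (Y : (B.baseChange K).toAffine.Point),
                ¬ IsOfFinAddOrder (WeierstrassCurve.QuadraticDescent.incl K B P) ∧
                (∀ Q : B.toAffine.Point, ∃ m : ℤ, IsOfFinAddOrder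
                  (WeierstrassCurve.QuadraticDescent.incl K B Q -
                    m • WeierstrassCurve.QuadraticDescent.incl K B P)) ∧
                ((qB * qA : ℚ) : ℝ) * canonicalHeight (WeierstrassCurve.QuadraticDescent.incl K B P) =
                  (2 : ℝ) ^ (if p % 9 = 4 then (0 : ℤ) else -2) * canonicalHeight Y) ∧
          -- (2) THE NAMING CLAUSE: the same display holds with `Y :=` Hu–Shu–Yin's point `R − T` on `E_p(K)`
          ∀ (ι₀ : K →+* ℂ),
          ∀ (y₁ : ((⟨0, 0, 1, 0, -1⟩ : WeierstrassCurve ℚ).baseChange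
              (ringClassField K ι₀ (9 * p))).toAffine.Point),
            Affine.Point.map (W' := (⟨0, 0, 1, 0, -1⟩ : WeierstrassCurve ℚ))
                (ringClassField K ι₀ (9 * p)).subtype.toRatAlgHom y₁ =
              Dt₀.φ (heegnerTau (81 * ((p : ℤ) ^ 2 + 4 * p + 16), -(9 * (4 * (p : ℤ) ^ 2 + 17 * p + 72)),
                4 * (p : ℤ) ^ 2 + 18 * p + 81)) →
          ∀ (c₃ cp : ringClassField K ι₀ (9 * p)), c₃ ^ 3 = 3 → cp ^ 3 = (p : ringClassField K ι₀ (9 * p)) →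
          ∀ (G : Finset (ringClassField K ι₀ (9 * p) ≃ₐ[ℚ] ringClassField K ι₀ (9 * p))),
            (∀ g, g ∈ G ↔ (∀ k : K, g (algebraMap K (ringClassField K ι₀ (9 * p)) k) =
              algebraMap K (ringClassField K ι₀ (9 * p)) k) ∧ g c₃ = c₃ ∧ g cp = cp) →
          ∀ (emb : ringClassField K ι₀ (9 * p) →+* AlgebraicClosure K),
            (∀ k : K, emb (algebraMap K (ringClassField K ι₀ (9 * p)) k) =
              algebraMap K (AlgebraicClosure K) k) →
          ∀ (ιpt : ((⟨0, 0, 1, 0, -1⟩ : WeierstrassCurve ℚ).baseChange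
                (ringClassField K ι₀ (9 * p))).toAffine.Point →+
              geomPoints (((⟨0, 0, 1, 0, -1⟩ : WeierstrassCurve ℚ)).baseChange K)),
            (∀ Q, ιpt Q = Affine.Point.map (W' := (⟨0, 0, 1, 0, -1⟩ : WeierstrassCurve ℚ))
              emb.toRatAlgHom Q) →
          ∀ (κ : geomPoints ((cubeSumCurve (9 : ℚ)).baseChange K) ≃+
              geomPoints (((⟨0, 0, 1, 0, -1⟩ : WeierstrassCurve ℚ)).baseChange K)),
            (∀ {x y : AlgebraicClosure K}
              (h : (((cubeSumCurve (9 : ℚ)).baseChange K).baseChange (AlgebraicClosure K)).toAffine.Nonsingular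
                x y),
              ∃ h', κ (Affine.Point.some x y h) = Affine.Point.some (x / 36) ((y - 108) / 216) h') →
          ∀ (v : AlgebraicClosure K), v ^ 3 = (p : AlgebraicClosure K) / 9 →
          ∀ (ψ : geomPoints ((cubeSumCurve (9 : ℚ)).baseChange K) ≃+
              geomPoints ((cubeSumCurve (p : ℚ)).baseChange K)),
            (∀ {x y : AlgebraicClosure K}
              (h : (((cubeSumCurve (9 : ℚ)).baseChange K).baseChange (AlgebraicClosure K)).toAffine.Nonsingular
                x y),
              ∃ h', ψ (Affine.Point.some x y h) = Affine.Point.some (v ^ 2 * x) (v ^ 3 * y) h') →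
          ∃ T : ((⟨0, 0, 1, 0, -1⟩ : WeierstrassCurve ℚ).baseChange (ringClassField K ι₀ (9 * p))).toAffine.Point,
            3 • T = 0 ∧
          ∃ Y₁ : ((cubeSumCurve (p : ℚ)).baseChange K).toAffine.Point,
            toGeomPoints ((cubeSumCurve (p : ℚ)).baseChange K) Y₁ =
              ψ (κ.symm (ιpt ((∑ g ∈ G, pointGalHom (⟨0, 0, 1, 0, -1⟩ : WeierstrassCurve ℚ)
                (ringClassField K ι₀ (9 * p)) g y₁) - T))) ∧
            ∀ (A B : WeierstrassCurve ℚ) [A.IsElliptic] [A.IsGloballyMinimal]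
                [B.IsElliptic] [B.IsGloballyMinimal] (CB : VariableChange ℚ)
                (hCB : CB • B = cubeSumCurve (p : ℚ)),
              (∃ C : VariableChange ℚ, C • A = cubeSumCurve (3 * (p : ℚ) ^ 2)) →
              ∃ qB qA : ℚ, shaAn B = (qB : ℂ) ∧ shaAn A = (qA : ℂ) ∧ qB * qA ≠ 0 ∧
                (B.baseChange K).mordellWeilRank = 2 ∧
                ∃ (P : B.toAffine.Point) (Y : (B.baseChange K).toAffine.Point),
                  ¬ IsOfFinAddOrder (WeierstrassCurve.QuadraticDescent.incl K B P) ∧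
                  (∀ Q : B.toAffine.Point, ∃ m : ℤ, IsOfFinAddOrder
                    (WeierstrassCurve.QuadraticDescent.incl K B Q -
                      m • WeierstrassCurve.QuadraticDescent.incl K B P)) ∧
                  ((qB * qA : ℚ) : ℝ) * canonicalHeight (WeierstrassCurve.QuadraticDescent.incl K B P) =
                    (2 : ℝ) ^ (if p % 9 = 4 then (0 : ℤ) else -2) * canonicalHeight Y ∧
                  Affine.Point.congrEquiv (congrArg (fun W : WeierstrassCurve ℚ ↦ W.baseChange K) hCB)
                    (VariableChange.pointEquivBaseChange B CB K Y) = Y₁ := by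
  intro p hp h49 h3 K _ _ ω hω h2
  obtain ⟨h₁, h₂⟩ := h p hp h49 h3 K ω hω h2
  exact ⟨h₁, fun ι₀ ↦ h₂ ι₀ Dt₀ hdeg₀⟩

end Summit.BirchSwinnertonDyer.BirchSwinnertonDyer.Theorems.SylvesterTwoHeightDisplayNamedDegSix

end
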